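import Summits.AtomisticToContinuum.FouriersLaw.Theorems.BondHeatUncertaintyExtensiveSnapshotIrreversibilityEnergyWindowSmoothDuhamelA

/-!
# «EnergyWindowSmoothDuhamel» (lens-1 g76 node P: Duhamel leaf and kernel leaf on the smooth core, (Dˢ) ∧ (G1) ∧ (G1*) ⟹ S3ˢ, C_c^∞ density toolbox, S3ˢ ⟹ S3) — part 2 of 2 (sequel of `…BondHeatUncertaintyExtensiveSnapshotIrreversibilityEnergyWindowSmoothDuhamelA`)

Split for the 400-line cap by the landing lane (hand-2 g30); the module docstring of part 1 (`…BondHeatUncertaintyExtensiveSnapshotIrreversibilityEnergyWindowSmoothDuhamelA`) describes the whole node.  Same namespace; all FQNs unchanged.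
0 sorry; standard axioms.
-/

noncomputable section

namespace Summit.AtomisticToContinuum.FouriersLaw.Theorems.ExtensiveSnapshotIrreversibility.EnergyWindow

open MeasureTheory ProbabilityTheory Filter Topology Real intervalIntegral
open scoped ENNReal NNReal ContDiff Convolution
open Literature.MathematicalPhysics.KineticTheory.HeatConduction
open Literature.Probability.Process

/-! ## 3. `C_c^∞` is `L¹`-dense in the measurable `w`-ball, within the `w`-ball -/

section Density

open Metric Set Function

/-- Clipping to `[-1, 1]` does not increase the distance to a point of `[-1, 1]`. [folklore] -/
theorem abs_sub_clip_le (k t : ℝ) (hk : |k| ≤ 1) : |k - max (-1) (min 1 t)| ≤ |k - t| := by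
  rw [abs_le] at hk
  rcases le_total 1 t with h1 | h1
  · rw [min_eq_left h1, max_eq_right (by norm_num : (-1 : ℝ) ≤ 1)]
    rw [abs_of_nonpos (by linarith), abs_of_nonpos (by linarith)]
    linarith
  · rw [min_eq_right h1]
    rcases le_total (-1) t with h2 | h2
    · rw [max_eq_right h2]
    · rw [max_eq_left h2, abs_of_nonneg (by linarith), abs_of_nonneg (by linarith)]
      linarith

/-- The clipped value lies in `[-1, 1]`. [folklore] -/
theorem abs_clip_le (t : ℝ) : |max (-1) (min 1 t)| ≤ 1 :=
  abs_le.2 ⟨le_max_left _ _, max_le (by norm_num) (min_le_left _ _)⟩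

variable {E : Type*} [NormedAddCommGroup E] [NormedSpace ℝ E] [FiniteDimensional ℝ E]
  [MeasurableSpace E] [BorelSpace E]

/-- **`C_c^∞` is `L¹(ν)`-dense in the measurable unit ball, within the unit ball**: for a finite
Borel measure `ν` on a finite-dimensional real normed space and a measurable `|k| ≤ 1` there are
smooth compactly supported `|g| ≤ 1` with `∫ |k − g| dν ≤ ε` (a continuous compactly supported
`L¹(ν)`-approximation — Mathlib's `Integrable.exists_hasCompactSupport_integral_sub_le` —,
clipping to `[-1,1]`, mollification by a normed bump at a radius given by uniform continuity;
`|φ ⋆ g₁| ≤ 1` because `φ ≥ 0`, `∫ φ = 1`).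
[cite: KatzourakisVarvaruca2018, Thm 9.31, Thm 9.44] -/
theorem exists_contDiff_hasCompactSupport_integral_sub_le (ν : Measure E) [IsFiniteMeasure ν]
    {k : E → ℝ} (hkm : AEStronglyMeasurable k ν) (hk1 : ∀ x, |k x| ≤ 1) {ε : ℝ} (hε : 0 < ε) :
    ∃ g : E → ℝ, ContDiff ℝ ∞ g ∧ HasCompactSupport g ∧ (∀ x, |g x| ≤ 1) ∧
      ∫ x, |k x - g x| ∂ν ≤ ε := by
  -- `k ∈ L¹(ν)`
  have hki : Integrable k ν :=
    (integrable_const (1 : ℝ)).mono' hkm (Eventually.of_forall fun x => by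
      rw [Real.norm_eq_abs]; exact hk1 x)
  -- a continuous compactly supported `L¹`-approximation
  obtain ⟨g₀, hg₀K, hg₀ε, hg₀c, hg₀i⟩ := hki.exists_hasCompactSupport_integral_sub_le (half_pos hε)
  -- clipped to `[-1, 1]`
  set c : ℝ → ℝ := fun t => max (-1) (min 1 t) with hc
  set g₁ : E → ℝ := c ∘ g₀ with hg₁
  have hg₁c : Continuous g₁ :=
    (continuous_const.max (continuous_const.min continuous_id)).comp hg₀c
  have hg₁K : HasCompactSupport g₁ := hg₀K.comp_left (g := c) (by simp [hc])
  have hg₁1 : ∀ x, |g₁ x| ≤ 1 := fun x => abs_clip_le _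
  have hkg₁ : ∀ x, |k x - g₁ x| ≤ |k x - g₀ x| := fun x => abs_sub_clip_le _ _ (hk1 x)
  -- mollified at a radius given by uniform continuity
  set η : ℝ := ε / 2 / (ν.real univ + 1) with hη
  have hm : 0 ≤ ν.real univ := measureReal_nonneg
  have hη0 : 0 < η := by positivity
  obtain ⟨ρ, hρ, hρu⟩ :=
    Metric.uniformContinuous_iff.mp (hg₁K.uniformContinuous_of_continuous hg₁c) η hη0
  set μH : Measure E := Measure.addHaar with hμH
  let φ : ContDiffBump (0 : E) := ⟨ρ / 2, ρ, half_pos hρ, half_lt_self hρ⟩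
  set g₂ : E → ℝ := φ.normed μH ⋆[ContinuousLinearMap.lsmul ℝ ℝ, μH] g₁ with hg₂
  have hg₂C : ContDiff ℝ ∞ g₂ :=
    φ.hasCompactSupport_normed.contDiff_convolution_left _ φ.contDiff_normed
      hg₁c.locallyIntegrable
  have hg₂K : HasCompactSupport g₂ := φ.hasCompactSupport_normed.convolution _ hg₁K
  have hg₂near : ∀ x, |g₁ x - g₂ x| ≤ η := fun x => by
    rw [abs_sub_comm, ← Real.dist_eq]
    exact φ.dist_normed_convolution_le hg₁c.aestronglyMeasurable
      (fun y hy => (hρu (mem_ball.1 hy)).le)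
  have hg₂1 : ∀ x, |g₂ x| ≤ 1 := fun x => by
    rw [← sub_zero (g₂ x), ← Real.dist_eq]
    exact dist_convolution_le zero_le_one φ.support_normed_eq.subset φ.nonneg_normed
      φ.integral_normed hg₁c.aestronglyMeasurable
      (fun y _ => by rw [Real.dist_eq, sub_zero]; exact hg₁1 y)
  -- the estimate `∫ |k − g₂| ≤ ∫ |k − g₀| + η ν(E) ≤ ε/2 + ε/2`
  refine ⟨g₂, hg₂C, hg₂K, hg₂1, ?_⟩
  have hpt : ∀ x, |k x - g₂ x| ≤ |k x - g₀ x| + η := fun x =>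
    (abs_sub_le (k x) (g₁ x) (g₂ x)).trans (add_le_add (hkg₁ x) (hg₂near x))
  have hI0 : Integrable (fun x => |k x - g₀ x|) ν := (hki.sub hg₀i).abs
  have hI : Integrable (fun x => |k x - g₀ x| + η) ν := hI0.add (integrable_const η)
  calc ∫ x, |k x - g₂ x| ∂ν ≤ ∫ x, (|k x - g₀ x| + η) ∂ν :=
        integral_mono_of_nonneg (Eventually.of_forall fun x => abs_nonneg _) hI
          (Eventually.of_forall hpt)
    _ = ∫ x, |k x - g₀ x| ∂ν + η * ν.real univ := by
        rw [integral_add hI0 (integrable_const η), MeasureTheory.integral_const, smul_eq_mul,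
          mul_comm (ν.real univ)]
    _ ≤ ε / 2 + ε / 2 := by
        gcongr
        · simpa only [Real.norm_eq_abs] using hg₀ε
        · rw [hη, div_mul_eq_mul_div, div_le_iff₀ (by positivity)]
          nlinarith
    _ = ε := add_halves ε

/-- **Weighted form**: for a smooth positive `ν`-integrable weight `w` and a measurable `|h| ≤ w`
there are smooth compactly supported `|g| ≤ w` with `∫ |h − g| dν ≤ ε` (the previous lemma for
`h/w` and the finite measure `w · ν`, multiplied back by `w`). [folklore] -/
theorem exists_contDiff_hasCompactSupport_integral_sub_le_of_abs_le (ν : Measure E)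
    {w : E → ℝ} (hwC : ContDiff ℝ ∞ w) (hw0 : ∀ x, 0 < w x) (hwi : Integrable w ν)
    {h : E → ℝ} (hhm : Measurable h) (hh : ∀ x, |h x| ≤ w x) {ε : ℝ} (hε : 0 < ε) :
    ∃ g : E → ℝ, ContDiff ℝ ∞ g ∧ HasCompactSupport g ∧ (∀ x, |g x| ≤ w x) ∧
      ∫ x, |h x - g x| ∂ν ≤ ε := by
  set νw : Measure E := ν.withDensity fun x => ENNReal.ofReal (w x) with hνw
  haveI : IsFiniteMeasure νw := isFiniteMeasure_withDensity_ofReal hwi.2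
  have hwm : Measurable w := hwC.continuous.measurable
  set k : E → ℝ := fun x => h x / w x with hk
  have hkm : Measurable k := hhm.div hwm
  have hk1 : ∀ x, |k x| ≤ 1 := fun x => by
    simp only [hk]
    rw [abs_div, abs_of_pos (hw0 x)]
    exact div_le_one_of_le₀ (hh x) (hw0 x).le
  obtain ⟨g₀, hg₀C, hg₀K, hg₀1, hg₀ε⟩ :=
    exists_contDiff_hasCompactSupport_integral_sub_le νw hkm.aestronglyMeasurable hk1 hε
  refine ⟨fun x => g₀ x * w x, hg₀C.mul hwC, hg₀K.mul_right, fun x => ?_, ?_⟩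
  · rw [abs_mul, abs_of_pos (hw0 x)]
    exact (mul_le_mul_of_nonneg_right (hg₀1 x) (hw0 x).le).trans_eq (one_mul _)
  · have hpt : ∀ x, |h x - g₀ x * w x| = (ENNReal.ofReal (w x)).toReal • |k x - g₀ x| := by
      intro x
      have hw := hw0 x
      have hkx : w x * k x = h x := by
        simp only [hk]; field_simp
      rw [ENNReal.toReal_ofReal hw.le, smul_eq_mul, ← hkx,
        show w x * k x - g₀ x * w x = w x * (k x - g₀ x) by ring, abs_mul, abs_of_pos hw]
    calc ∫ x, |h x - g₀ x * w x| ∂ν = ∫ x, (ENNReal.ofReal (w x)).toReal • |k x - g₀ x| ∂ν :=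
          integral_congr_ae (Eventually.of_forall hpt)
      _ = ∫ x, |k x - g₀ x| ∂νw :=
          (integral_withDensity_eq_integral_toReal_smul hwm.ennreal_ofReal
            (Eventually.of_forall fun x => ENNReal.ofReal_lt_top) _).symm
      _ ≤ ε := hg₀ε

end Density

/-! ## 4. ★ `S3ˢ ⟹ S3`: density in `L¹` of both kernels at `z` -/

/-- ★ **`S3ˢ → S3`.**  Given `0 < θ < θ' < 1/T` take S3ˢ's `δ₀, C` and shrink `δ₀` below
`min(T, 1/θ − T)` so that both bath temperatures `T ± δ/2` lie in `(0, 1/θ)`; then `e^{θH}` is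
integrable for `ν = P^δ_1(z,·) + P^0_1(z,·)` (CEHR (3.4)), and for a measurable `|h| ≤ e^{θH}`
and `ε > 0` a smooth compactly supported `|g| ≤ e^{θH}` with `∫ |h − g| dν ≤ ε` gives
`|P^δ_1 h(z) − P^0_1 h(z)| ≤ |P^δ_1 g(z) − P^0_1 g(z)| + ε ≤ C |δ| e^{θ'H(z)} + ε`.
[cite: CuneoEckmannHairerReyBellet2018, §3 eq. (3.4)] -/
theorem kernelTemperatureLipschitz_of_smooth (hS : KernelTemperatureLipschitzSmooth) :
    KernelTemperatureLipschitz := by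
  intro ω₂ lam β γ hω hl hβ hγ T hT N hN θ θ' hθ hθθ' hθ'1
  obtain ⟨δ₀, C, hδ₀, hmain⟩ := hS ω₂ lam β γ hω hl hβ hγ T hT N hN θ θ' hθ hθθ' hθ'1
  have hN0 : 0 < N := by omega
  have hθ1 : θ < 1 / T := hθθ'.trans hθ'1
  have hθT : T < 1 / θ := by
    rw [lt_div_iff₀ hθ]
    have := (lt_div_iff₀ hT).1 hθ1
    linarith [mul_comm θ T]
  set Hm := (pinnedChain ω₂ lam β γ).hamiltonian N with hHm
  -- the weight `w = e^{θH}`: smooth, positive, dominated by `1 · e^{θH}`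
  set w : PhaseSpace N → ℝ := fun y => Real.exp (θ * Hm y) with hw
  have hwC : ContDiff ℝ ∞ w :=
    (contDiff_const.mul (pinnedChain_contDiff_hamiltonian ω₂ lam β γ N)).exp
  have hw0 : ∀ y, 0 < w y := fun y => Real.exp_pos _
  have hwm : Measurable w := hwC.continuous.measurable
  have hwle : ∀ y, |w y| ≤ 1 * Real.exp (θ * Hm y) := fun y => by
    rw [one_mul, hw, abs_of_pos (Real.exp_pos _)]
  refine ⟨min δ₀ (min T (1 / θ - T)), C, lt_min hδ₀ (lt_min hT (by linarith)),
    fun δ hδ z h hhm hh => ?_⟩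
  have hδ0 : |δ| < δ₀ := hδ.trans_le (min_le_left _ _)
  have hδT : |δ| < T := (hδ.trans_le (min_le_right _ _)).trans_le (min_le_left _ _)
  have hδθ : |δ| < 1 / θ - T := (hδ.trans_le (min_le_right _ _)).trans_le (min_le_right _ _)
  have hδabs := abs_lt.1 hδT
  have hδabs' := abs_lt.1 hδθ
  -- both bath temperatures in `(0, 1/θ)`
  have hL : 0 < T + δ / 2 := by linarith
  have hR : 0 < T - δ / 2 := by linarith
  have hmaxpos : 0 < max (T + δ / 2) (T - δ / 2) := lt_max_of_lt_left hL
  have hmaxlt : max (T + δ / 2) (T - δ / 2) < 1 / θ := max_lt (by linarith) (by linarith)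
  have hθδ : θ < 1 / max (T + δ / 2) (T - δ / 2) := by
    rw [lt_div_iff₀ hmaxpos]
    have := (lt_div_iff₀ hθ).1 hmaxlt
    linarith [mul_comm θ (max (T + δ / 2) (T - δ / 2))]
  have hθ0 : θ < 1 / max T T := by rwa [max_self]
  -- the two kernels at `z` and their sum
  set ν₁ : Measure (PhaseSpace N) :=
    (pinnedChain ω₂ lam β γ).transitionKernel N (T + δ / 2) (T - δ / 2) 1 z with hν₁
  set ν₂ : Measure (PhaseSpace N) := (pinnedChain ω₂ lam β γ).transitionKernel N T T 1 z with hν₂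
  have hw1 : Integrable w ν₁ :=
    (integrable_and_abs_integral_transitionKernel_le hω hl hβ hγ hN0 hL hR hθ hθδ 1 z zero_le_one
      hwm hwle).1
  have hw2 : Integrable w ν₂ :=
    (integrable_and_abs_integral_transitionKernel_le hω hl hβ hγ hN0 hT hT hθ hθ0 1 z zero_le_one
      hwm hwle).1
  have hwi : Integrable w (ν₁ + ν₂) := hw1.add_measure hw2
  have hhle : ∀ y, |h y| ≤ 1 * Real.exp (θ * Hm y) := fun y => by rw [one_mul]; exact hh y
  have hh1 : Integrable h ν₁ :=
    (integrable_and_abs_integral_transitionKernel_le hω hl hβ hγ hN0 hL hR hθ hθδ 1 z zero_le_one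
      hhm hhle).1
  have hh2 : Integrable h ν₂ :=
    (integrable_and_abs_integral_transitionKernel_le hω hl hβ hγ hN0 hT hT hθ hθ0 1 z zero_le_one
      hhm hhle).1
  -- `ε`-approximation by the core
  refine le_of_forall_pos_le_add fun ε hε => ?_
  obtain ⟨g, hgC, hgK, hgw, hgε⟩ :=
    exists_contDiff_hasCompactSupport_integral_sub_le_of_abs_le (ν₁ + ν₂) hwC hw0 hwi hhm
      (fun y => hh y) (half_pos hε)
  have hgm : Measurable g := hgC.continuous.measurable
  have hgle : ∀ y, |g y| ≤ 1 * Real.exp (θ * Hm y) := fun y => by rw [one_mul]; exact hgw y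
  have hg1 : Integrable g ν₁ :=
    (integrable_and_abs_integral_transitionKernel_le hω hl hβ hγ hN0 hL hR hθ hθδ 1 z zero_le_one
      hgm hgle).1
  have hg2 : Integrable g ν₂ :=
    (integrable_and_abs_integral_transitionKernel_le hω hl hβ hγ hN0 hT hT hθ hθ0 1 z zero_le_one
      hgm hgle).1
  have hS := hmain δ hδ0 z g hgC hgK hgw
  -- `∫ |h − g| dνᵢ ≤ ∫ |h − g| d(ν₁ + ν₂) ≤ ε/2`
  have hdi : Integrable (fun y => |h y - g y|) (ν₁ + ν₂) :=
    ((hh1.add_measure hh2).sub (hg1.add_measure hg2)).abs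
  have hd1 : ∫ y, |h y - g y| ∂ν₁ ≤ ε / 2 :=
    (integral_mono_measure (Measure.le_add_right le_rfl)
      (Eventually.of_forall fun y => abs_nonneg _) hdi).trans hgε
  have hd2 : ∫ y, |h y - g y| ∂ν₂ ≤ ε / 2 :=
    (integral_mono_measure (Measure.le_add_left le_rfl)
      (Eventually.of_forall fun y => abs_nonneg _) hdi).trans hgε
  -- assemble
  have e1 : ∫ y, h y ∂ν₁ = ∫ y, g y ∂ν₁ + ∫ y, (h y - g y) ∂ν₁ := by
    rw [integral_sub hh1 hg1]; ring
  have e2 : ∫ y, h y ∂ν₂ = ∫ y, g y ∂ν₂ + ∫ y, (h y - g y) ∂ν₂ := by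
    rw [integral_sub hh2 hg2]; ring
  rw [e1, e2]
  calc |∫ y, g y ∂ν₁ + ∫ y, (h y - g y) ∂ν₁ - (∫ y, g y ∂ν₂ + ∫ y, (h y - g y) ∂ν₂)|
      = |(∫ y, g y ∂ν₁ - ∫ y, g y ∂ν₂) + (∫ y, (h y - g y) ∂ν₁ - ∫ y, (h y - g y) ∂ν₂)| := by
        ring_nf
    _ ≤ |∫ y, g y ∂ν₁ - ∫ y, g y ∂ν₂| + |∫ y, (h y - g y) ∂ν₁ - ∫ y, (h y - g y) ∂ν₂| :=
        abs_add_le _ _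
    _ ≤ C * |δ| * Real.exp (θ' * Hm z) + (|∫ y, (h y - g y) ∂ν₁| + |∫ y, (h y - g y) ∂ν₂|) :=
        add_le_add hS (abs_sub _ _)
    _ ≤ C * |δ| * Real.exp (θ' * Hm z) + (∫ y, |h y - g y| ∂ν₁ + ∫ y, |h y - g y| ∂ν₂) := by
        gcongr <;> exact abs_integral_le_integral_abs
    _ ≤ C * |δ| * Real.exp (θ' * Hm z) + (ε / 2 + ε / 2) := by gcongr
    _ = C * |δ| * Real.exp (θ' * Hm z) + ε := by rw [add_halves]

/-! ## 5. The junctions through the smooth core -/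

/-- ★ **`(Dˢ) → (G1) → (G1*) → S3`.** [folklore] -/
theorem kernelTemperatureLipschitz_of_smoothDuhamel (hD : KernelTemperatureDuhamelSmooth)
    (hG : EqualTemperatureBathGradient) (hI : PerturbedKernelMomentumIBP) :
    KernelTemperatureLipschitz :=
  kernelTemperatureLipschitz_of_smooth (kernelTemperatureLipschitzSmooth_of_duhamelSmooth hD hG hI)

/-- ★★ **`S3 ⟸ (Dˢ) ∧ (G1ᶜ) ∧ (G1*ᶜ)`**: the Duhamel identity on the smooth core and the two
weighted small-time gradient cores of the smooth hypoelliptic kernel (part O) give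
`KernelTemperatureLipschitz`. [cite: CuneoEckmannHairerReyBellet2018, §3] -/
theorem kernelTemperatureLipschitz_of_smoothDuhamel_of_cores (hD : KernelTemperatureDuhamelSmooth)
    (hG : DepartureGradientCore) (hA : ArrivalGradientCore) : KernelTemperatureLipschitz :=
  kernelTemperatureLipschitz_of_smoothDuhamel hD
    (equalTemperatureBathGradient_of_departureDensityGradient
      (departureDensityGradientBound_of_core hG))
    (perturbedKernelMomentumIBP_of_arrivalDensityGradient (arrivalDensityGradientBound_of_core hA))

/-- **Glue `A0 → A2 → (Dˢ) → (G1ᶜ) → (G1*ᶜ) → A3p → A4 → (W)`.** [folklore] -/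
theorem energyWindowControl_of_atoms₇P (h0 : NessGibbsReweighting) (h2 : NessOddLogRatioBound)
    (hD : KernelTemperatureDuhamelSmooth) (hG : DepartureGradientCore) (hA : ArrivalGradientCore)
    (h3p : NessFloorMeanValue) (h4 : NessLinearResponseL2) : EnergyWindowControl :=
  energyWindowControl_of_atoms₅K h0 h2
    (kernelTemperatureLipschitz_of_smoothDuhamel_of_cores hD hG hA) h3p h4

/-- ★ **The junction `K_fix ⟸ A0 ∧ A2 ∧ (Dˢ) ∧ (G1ᶜ) ∧ (G1*ᶜ) ∧ A3p ∧ A4`.** [folklore] -/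
theorem snapshotKLUpperExpansion_of_atoms₇P (h0 : NessGibbsReweighting)
    (h2 : NessOddLogRatioBound) (hD : KernelTemperatureDuhamelSmooth)
    (hG : DepartureGradientCore) (hA : ArrivalGradientCore)
    (h3p : NessFloorMeanValue) (h4 : NessLinearResponseL2) : SnapshotKLUpperExpansion :=
  snapshotKLUpperExpansion_of_atoms₅K h0 h2
    (kernelTemperatureLipschitz_of_smoothDuhamel_of_cores hD hG hA) h3p h4

end Summit.AtomisticToContinuum.FouriersLaw.Theorems.ExtensiveSnapshotIrreversibility.EnergyWindow

end
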